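import Literature.Computability.AlgebraicComplexity.MS08Obstructions
import Literature.NumberTheory.DiophantineGeometry.SymmetricGroupReps
import HarnessLib

/-!
# Mulmuley–Sohoni, GCT II (SIAM J. Comput. 38, 2008), §6–§12: the representation-theoretic data
# `Π_v`, `Σ_v`, the second fundamental theorems, partial stability, Borel–Weil, `G`-separability —
# crosswalk, with the typeable statements typed as printed

Typed literature for cell `val-lit` (DAG row MS08-B; typer `val-lit-t02`); companion of
`MS08Obstructions.lean` (§1–§5), whose module docstring fixes the source, the numbering convention
(JOURNAL numbers = e-print numbers minus one in the section; TeX line locators `[Lnnn]` of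
`pub-gct/inputs/files/src/cs_0612134/main.tex`) and the dictionary between MS's setting
(`G = SL(Y)` acting on `V = Sym^m(Y)`, `R_V[v]`, `I_V[v]`, `G_v̂`) and the tree's vocabulary
(`slSubgroup`, `coordRep`, `OrbitCoordRing`/`orbitCoordRingDeg`, `orbitVanishingIdeal`,
`linStabilizer`). Honest framing: bookkeeping of published statements; VP ≠ VNP is NOT proved and
nothing here is progress on it. [MulmuleySohoniGCT2SIAM2008]

WHY MOST OF §6–§12 IS NOT TYPED. The results of these sections are stated for an arbitrary
connected reductive group `G`, parabolic subgroups `P = KU = TLU`, Kempf's `(R,P)`-stability, Levi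
data, homogeneous bundles `G ×_H M`, twisting sheaves `𝒪(d)` on `Δ_V[v]`, projective normality,
Luna's étale slice theorem and quotients `X → X/G` of nonsingular affine `G`-varieties. None of
these notions exists in Mathlib or in the tree (no linear algebraic groups, no parabolic/Levi
theory, no GIT quotients), and the cell's rule is that absent NOTIONS are not replaced by ad-hoc
structures (val-lit DAG row MS08-A note; FACT-LIST R1). What IS typeable — the data `Π_v`, `Σ_v`
of Def. 6.1 for the tree's setting and Prop. 6.2, the special cases of Thms. 8.2 / 9.1 the tree
already proves, and the purely combinatorial reformulation of the `G`-separability statement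
proved in §12 (Prop. 12.5, `n = 2`) — is typed below; everything else is recorded item by item
with the reason.

## Crosswalk §6–§12 (every numbered item; CITE = already in the tree, NEW = this file)

§6 SFT for the orbit of a stable, excellent point (e-print §7) `[L1175–1850]`
* **Def. 6.1** `[defnnonadmissibledata_new, L1185–1196]` ("`Σ_v` = the set of all
  non-`G_v̂`-admissible `G`-submodules of `ℂ[V]` … `Π_v(d)` = the set of all irreducible
  `G`-submodules of `ℂ[V]` whose duals do not contain a `G_v`-submodule isomorphic [to] `(ℂv)^d`")
  — NEW `IsPiDatum G v m d W`, `IsSigmaDatum G v m W` (and the dual variant `IsDualSigmaDatum`,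
  which is what the proofs use; for reductive `G_v̂` — automatic for stable `v` by Matsushima
  `[L1189–1190]` — the two agree by Weyl's theorem, not formalised), over `G`-submodules
  `W : Subrepresentation (coordRep σ k m)` of `k[V] = k[Sym^m(k^σ)]`.
* "Clearly `Σ_v ⊆ Π_v`" `[L1198]` — NEW PROVED in dual form `IsDualSigmaDatum.isPiDatum`.
* **Prop. 6.2** `[pcnonadideal_new1, L1203–1208]` ("If `v` is stable, the `G`-modules in the
  representation-theoretic data `Π_v`, and hence `Σ_v`, associated with `v` are contained in
  `I_V[v]`. This follows from Proposition 4.2") — NEW PROVED `IsPiDatum.le_orbitVanishingIdeal`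
  (for any `v ≠ 0` with `G · [v] = GL · [v]`, e.g. `G = SL` over `ℂ` or `G = GL`; stability is only
  used in print to make `Σ_v` meaningful) and `IsDualSigmaDatum.le_orbitVanishingIdeal`.
* **Def. 6.3** `[dgseparable, L1213–1224]` (`G`-separable / strongly `G`-separable `H`-modules and
  subgroups: "there exists an irreducible non-`H`-admissible `G`-module `M` that contains `L`")
  — NOT TYPED as a definition: it quantifies over the category of rational `G`-modules of a
  reductive group; its combinatorial reformulation for the pair
  `SL_n × SL_n ⊆ SL_{n²}` `[L3349–3394]` is typed in §12 below (Kronecker coefficients).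
* **Thm. 6.4** `[tnonadmissibility_new2, L1248–1266]` (SFT for the orbit of a stable excellent
  point with `G`-separable stabilizer: the ideal of `Gv` in `U = V_β` is generated by the
  nonadmissible basis elements of `Σ_v`, indeed by `< codim(Gv, P(V))` irreducible non-admissible
  `G`-submodules) and **Thm. 6.5** `[tnonadmrel, L1311–1329]` (the same for a closed orbit in a
  nonsingular affine `G`-variety `X`, neighbourhood `X(β)`) — NOT TYPED (R1: étale slice theorem,
  saturated open sets of `X → X/G`, normal spaces `N_x`, `N_{[x]}`; no `G`-varieties in Mathlib).
* **Prop. 6.6** `[galbal, L1375–]`, **Lemmas 6.7–6.12** `[lfirststep L1422; eqspan1 L1507; eqspan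
  L1519; lcartanoka L1617; lpowerexp L1645; lcrucial L1714]` — proof-internal (Peter–Weyl spans,
  Cartan decomposition, power-series expansion); NOT TYPED.

§7 Partial stability (e-print §8) `[L1851–1970]`
* **Def. 7.1** `[dpartiallystable, L1856–1861]` ("`v ∈ P(V)` is `(R,P)`-stable (partially stable)
  if (1) it is stable with respect to the restricted action of `R` on `V`, and (2)
  `U ⊆ G_v ⊆ P`"; defect `δ(v)` = rank difference of the root systems of `R` and `K`), Examples 1–2
  `[L1877–1900]` (highest weight vector: `(L,P)`-stable, defect 0; `f = φ(h)`: `(R,P)`-stable with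
  defect one, `R ≃ SL_k × SL_{l-k-1}`), **Def. 7.2** `[drestr, L1903–1908]` (`α ⊲_R^K β`: `V_α(R)`
  occurs in `V_β(K)`), **Def. 7.3** `[dlieover, L1945–1959]` ("`β` lies over `μ` at `v` and degree
  `d`") — NOT TYPED (R1: parabolic `P = KU`, Levi subgroups, root-system ranks, Littelmann's
  restriction rule). The one ingredient the tree has is clause (1) for `R = SL(X)`: MS's `h = perm`
  is `SL(X)`-stable (`BurgisserIkenmeyer2017_polystable_det_per_holds`), and the padded permanent is
  NOT `SL(Y)`-stable (`paddedPerPoly_not_isPolystable`, companion file).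

§8 Borel–Weil for a partially stable point (e-print §9) `[L1971–2335]`
* **Thm. 8.1** `[tlieoverpstable, L1976–1987]` and **Thm. 8.2** `[tlieoverrefined, L2037–2080]`
  (Borel–Weil for partially stable points, (1)–(4)) — general form NOT TYPED (R1, notions of §7
  plus twisting sheaves / projective normality in (2)). CITE the special case of **Thm. 8.2 (1)**
  with `W = W' ⊕ W''`, `K = GL(W') × GL(W'')` (= BLMW 2011 Prop. 6.3.2 "special cases of the first
  part of Theorem 6.1.5 [= MS2 Thm 8.2]"), PROVED multiplicity-exactly in
  `OrbitClosureInheritance.lean`: `orbitMultiplicity_rename_extend`, `orbitMultiplicity_rename_eq`,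
  `hasHighestWeight_orbitCoordRep_rename_extend_iff`, and its padded-permanent instance
  `orbitMultiplicity_paddedPerFormLex_eq_paddedPerSmall` (`PaddedPermanentInheritance.lean`);
  **Thm. 8.2 (4)** for the stable point `v ∈ P(Y)` under `R` is Thm. 1.8 (a) = the named fact
  `MS08_thm_1_8a` (companion file).
* Remark 2 `[L2088–2098]` (Thm. 8.2 (2) specialises to the Borel–Weil theorem
  `Γ(G/P, 𝒪(d))^* = V_{dλ}(G)` [knapp]) and **Lemma 8.3** `[lknapp, L2116–2123]` (Knapp, Thm. 5.104:
  `V_λ(G)^U = V_λ(K)`), **Prop. 8.4** `[plift, L2170–2182]`, **Prop. 8.5** `[pbranch, L2266–2276]`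
  — classical / proof-internal; NOT TYPED (R1).

§9 Application in complexity theory (e-print §10) `[L2336–2439]`
* **Thm. 9.1 (a)** `[tlieoverovercomplexity, L2362–2365]` ("Suppose `g ∈ P(V)` is stable … Then a
  Weyl module `V_λ(G)` occurs in `Δ_V[g]` iff it is `G_ĝ`-admissible"; "(a) follows from Theorem
  1.8 (a)") — = the named fact `MS08_thm_1_8a` of the companion file (same special case
  `V = Sym^m(Y)`; for `g = det_m` the hypotheses are `isStableExcellent_detPoly`).
* **Thm. 9.1 (b)(1)** `[L2367–2370]` ("`V_λ(Ĝ)` can occur in `R_V[f]_d` only if the weight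
  `i^l(λ)` corresponds to a Young diagram with `md` boxes and height at most `k+1`") — CITE, PROVED
  in the tree for the padded permanent: `Complexity.bip2019_thm_2_1_holds` /
  `Complexity.exists_partition_of_hasHighestWeight_paddedPerOrbitRep_holds` (shape `λ ⊢ md`,
  `ℓ(λ) ≤ n² + 1 = k + 1`, Kadish–Landsberg 2014 / BIP 2019 Thm. 2.1(1)) and, for any form in a
  subset of the variables, `apply_eq_zero_of_hasHighestWeight_orbitCoordRep_of_vars_subset`
  (BIP 2019 Thm. 4.9(1)); the letters: MS's `k + 1 = n² + 1` variables `X̄ = X ∪ {y}`.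
* **Thm. 9.1 (b)(2) and the converse** `[L2370–2379]` ("`V_{λ'}(GL_{k+1})` … contains some
  `SL_k(ℂ)_ĥ`-admissible module `V_μ(SL_k)` … related by (a variant of) Pieri's branching rule";
  "Conversely, for every `SL_k(ℂ)_ĥ`-admissible module `V_μ(SL_k)` there exists a `d` and `λ` …")
  — NOT TYPED as printed ("details are left to the reader" `[L2429–2430]`; needs Thm. 8.2 (3) with
  Littelmann/Pieri branching data). The quantitative Pieri-form inequalities the tree DOES prove
  for padded forms `x_t^e · ι h` — `orbitMultiplicity_pad_le_add_sum_hwDeficit_pieri`,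
  `orbitMultiplicity_pad_le_detFormLex_add_capDeficitSumPieri` (`CapabilityBound.lean`) — are the
  tree's substitute in the per/det setting.

§10 Representation-theoretic data for a partially stable point (e-print §11) `[L2440–2618]`
* **Def. 10.1** `[defnnonadmissibledata_new2, L2447–2458]` (admissible `G`-submodules
  `M ⊆ ℂ[V]_d` w.r.t. an `(R,P)`-stable `v`: `(M^*)^U` is `(K, Sym^d(W))`-admissible and
  `R_v̂`-admissible; `Σ_v`, `Σ_v(d)`), **Prop. 10.2** `[pcnonadideal_new2, L2465–2469]` — NOT TYPED
  (R1: unipotent radical `U`, Levi `K`); for a STABLE point (`P = G`, `U = 1`, `K = R = G`) they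
  reduce to Def. 6.1 / Prop. 6.2, typed below (`IsRelAdmissible` of the companion file renders
  "`(K, Sym^d(W))`-admissible").
* §10.1 Example `G/P`, **Prop. 10.3** `[pgmodp, L2558–2566]` ("(1) `ℂ[V]_d = V_{dλ}(G)^* ⊕ Σ_v(d)`.
  (2) `R_V[v]_d = V_{dλ}(G)^*`. (3) `I_V[v]` is generated by the basis elements of `Σ_v(2)`" for
  `v` the highest weight vector, `Δ_V[v] ≅ G/P`; Plücker / straightening relations [smt]) —
  NOT TYPED (flag varieties, Borel–Weil; classical, R1).

§11 SFT for the orbit of a partially stable, excellent point (e-print §12) `[L2619–3044]`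
* **Thm. 11.1** `[tpstableorbitnoad, L2635–2652]` (for `V = V_λ(G)`, `v` `(R,P)`-stable of defect
  zero with `L ⊆ R ⊆ K`, `R_v̂` `R`-separable and characterizing `v`: `Gv` is cut out by `Σ_v` in a
  `G`-invariant neighbourhood), **Props. 11.2–11.3** `[L2700; pgmodpextend L2713]`, **Lemma 11.4**
  `[lknappextend, L2770]`, Claims `[L2789, L2963]` — NOT TYPED (R1: as Thm. 6.4 plus the bundle
  `G ×_P W`, reduction to the stable case).

§12 `G`-separability (e-print §13) `[L3045–3737]`
* **Prop. 12.1** `[pbasicsep, L3051–3060]` ("(1) A semisimple group `H`, embedded in `G = H × H`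
  diagonally, is strongly `G`-separable. (2) `H = SL_k(ℂ)` is a strongly `G`-separable subgroup of
  `G = SL_n(ℂ)` if `k > (n+1)/2`. (3) `H = SL_k(ℂ) × SL_l(ℂ) ⊆ G = SL_{k+l}(ℂ)` … is strongly
  `G`-separable") — NOT TYPED (Def. 6.3 not typed; R1: branching rules (eqfulton1) `[L3171]`).
* **Conj. 12.2** `[L3318–3320]` ("`SL_n(ℂ) × SL_n(ℂ)` is a strongly separable subgroup of
  `SL_{n²}(ℂ)`") and its reformulation **Conj. 12.3** `[conjsln, L3327–3334]` — OPEN CONJECTURES: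
  not Literature, not declared (they would be `@[conjecture]` route items). MS's symmetric-group
  reformulation `[L3385–3394]` ("For every nontrivial pair of Young diagrams `(λ, μ)` of height less
  than `n`, and such that `|λ| = |μ| (mod n)`, there exists an `m = |λ| = |μ| (mod n)`, `m ≥ n`, and a
  `ρ` of size `m` such that `W_ρ` occurs in the decomposition of `W_{λ(m)} ⊗ W_{μ(m)}` as an
  `S_m`-module, but not in the decomposition of `W_δ ⊗ W_δ`, where `δ` is the rectangular Young
  diagram of height `n` and size `m`") is expressible over the tree's Kronecker coefficients
  `Literature.NumberTheory.DiophantineGeometry.kroneckerCoeff` and is the SHAPE used below.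
* **Prop. 12.4** `[L3401–3403]` ("If `|λ| = |μ| ≠ 0 (mod n)`, Conjecture 12.3 holds" — vacuously,
  "no such `δ` exists") — not typed separately (vacuous case).
* **Prop. 12.5** `[psl2, L3409–3411]` ("Conjecture 12.3 holds for `n = 2`"; proof `[L3417–3737]`
  via the explicit two-row Kronecker products of Remmel–Whitehead (eqremwhite) and a case analysis)
  — NEW NAMED FACT `MS08_prop_12_5`, typed in the symmetric-group form the proof establishes
  `[L3417–3420]` ("for every nontrivial pair of `(λ, μ)` of row-shaped Young diagrams, with `|λ|`
  and `|μ|` even, there exists an even `m` …"); R1 (two-row Kronecker product formulas are not in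
  the tree; each INSTANCE is a finite `kroneckerCoeff` computation).

## What is deliberately NOT here
No conjecture is declared (Conj. 1.10, 12.2, 12.3 are pointers); no `instance`, no notation; one
new named fact (`MS08_prop_12_5`); the other new declarations are definitions with bodies and
proved theorems.
-/

noncomputable section

open MvPolynomial Representation

namespace Literature.Computability.AlgebraicComplexity

/-! ## §6 Def. 6.1 and Prop. 6.2: the data `Π_v`, `Σ_v` `[L1185–1208]` -/

section PiSigma

variable {σ k : Type*} [Fintype σ] [DecidableEq σ] [Field k]

/-- **`W ∈ Π_v(d)`** (Mulmuley–Sohoni 2008, Def. 6.1 `[tex:cs_0612134 main.tex L1192–1196]`: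
"`Π_v(d)` is the set of all irreducible `G`-submodules of `ℂ[V]` whose duals do not contain a
`G_v`-submodule isomorphic [to] `(ℂ v)^d`"), for the tree's `k[V] = k[Sym^m(k^σ)]`
(`MvPolynomial (DegIdx σ m) k` with the action `coordRep σ k m`): `W` is a `GL`-subrepresentation
lying in degree `d` (MS's "basis elements are homogeneous" `[L1305]`), irreducible, and no nonzero
linear functional on `W` transforms like evaluation at `v̂^d` under the stabilizer in `G` of the
line `[v]` (`IsEvalSemiInvariant`, companion file; = "the dual contains no `G_v`-module
`≅ (ℂv)^d`"). `G` is MS's acting group (`slSubgroup σ k` for `SL(Y)`, `⊤` for `Ĝ = GL(Y)`).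
[cite: MulmuleySohoniGCT2SIAM2008, Def. 6.1 (arXiv cs/0612134 Def. 7.1, main.tex L1185–1196)] -/
def IsPiDatum (G : Subgroup (GL σ k)) (v : MvPolynomial σ k) (m d : ℕ)
    (W : Subrepresentation (coordRep σ k m)) : Prop :=
  W.toSubmodule ≤ homogeneousSubmodule (DegIdx σ m) k d ∧ W.toRepresentation.IsIrreducible ∧
    ∀ φ : W.toSubmodule →ₗ[k] k, IsEvalSemiInvariant G v d W.toRepresentation φ → φ = 0

/-- **`W ∈ Σ_v`** (Mulmuley–Sohoni 2008, Def. 6.1 `[L1188–1190]`: "`Σ_v` [is] the set of all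
non-`G_v̂`-admissible `G`-submodules of `ℂ[V]`– here `G_v̂` is necessarily reductive"), as printed:
the `G`-submodule `W` of `k[Sym^m]` contains no nonzero vector fixed by `G ∩ G_v̂`
(`IsAdmissible`, `BLMW11StabilityInheritance.lean`).
[cite: MulmuleySohoniGCT2SIAM2008, Def. 6.1 (arXiv cs/0612134 Def. 7.1, main.tex L1185–1190)] -/
def IsSigmaDatum (G : Subgroup (GL σ k)) (v : MvPolynomial σ k) (m : ℕ)
    (W : Subrepresentation (coordRep σ k m)) : Prop :=
  ¬ IsAdmissible W.toRepresentation (G ⊓ linStabilizer v)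

/-- **`W ∈ Σ_v`, dual form**: the dual `W^*` contains no nonzero `(G ∩ G_v̂)`-invariant functional
(`IsDualAdmissible`, companion file). This is the form in which non-admissibility is USED in MS's
proofs (Prop. 4.2 produces invariants in `S^*`); for reductive `G_v̂` it is equivalent to
`IsSigmaDatum` by Weyl's complete reducibility `[L1014–1018]` (not formalised).
[cite: MulmuleySohoniGCT2SIAM2008, Def. 6.1 with Def. 4.1 (main.tex L1185–1190, L1010–1018)] -/
def IsDualSigmaDatum (G : Subgroup (GL σ k)) (v : MvPolynomial σ k) (m : ℕ)
    (W : Subrepresentation (coordRep σ k m)) : Prop :=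
  ¬ IsDualAdmissible (G ⊓ linStabilizer v) W.toRepresentation

/-- A functional transforming like evaluation at `v̂^d` under the stabilizer of `[v]` in `G` is in
particular invariant under `G ∩ G_v̂` (take `c = 1`). [cite: MulmuleySohoniGCT2SIAM2008, §6 "Clearly Σ_v ⊆ Π_v" (main.tex L1198)] -/
theorem IsEvalSemiInvariant.comp_eq_self {G : Subgroup (GL σ k)} {v : MvPolynomial σ k} {d : ℕ}
    {V : Type*} [AddCommGroup V] [Module k V] {ρ : Representation k (GL σ k) V} {φ : V →ₗ[k] k}
    (hφ : IsEvalSemiInvariant G v d ρ φ) {γ : GL σ k} (hγ : γ ∈ G ⊓ linStabilizer v) :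
    φ ∘ₗ ρ γ = φ := by
  have h := hφ γ (Subgroup.mem_inf.mp hγ).1 1
    (by rw [one_smul]; exact mem_linStabilizer.mp (Subgroup.mem_inf.mp hγ).2)
  rwa [inv_one, one_pow, one_smul] at h

/-- **"Clearly `Σ_v ⊆ Π_v`"** (Mulmuley–Sohoni 2008, §6 `[L1198]`), in the dual form: an
irreducible `G`-submodule `W` of `k[Sym^m]_d` whose dual has no nonzero `(G ∩ G_v̂)`-invariant lies
in `Π_v(d)`. [cite: MulmuleySohoniGCT2SIAM2008, §6 after Def. 6.1 (main.tex L1198)] -/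
theorem IsDualSigmaDatum.isPiDatum {G : Subgroup (GL σ k)} {v : MvPolynomial σ k} {m d : ℕ}
    {W : Subrepresentation (coordRep σ k m)} (hS : IsDualSigmaDatum G v m W)
    (hWd : W.toSubmodule ≤ homogeneousSubmodule (DegIdx σ m) k d)
    (hirr : W.toRepresentation.IsIrreducible) : IsPiDatum G v m d W := by
  refine ⟨hWd, hirr, fun φ hφ => ?_⟩
  by_contra hne
  exact hS ⟨φ, hne, fun γ hγ => hφ.comp_eq_self hγ⟩

/-- If `γ · f = c • f` with `f ≠ 0` then `c ≠ 0` (private copy of the companion file's helper).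
[folklore] -/
private theorem ne_zero_of_linSubstRep_eq_smul' {γ : GL σ k} {f : MvPolynomial σ k} {c : k}
    (hf : f ≠ 0) (h : linSubstRep σ k γ f = c • f) : c ≠ 0 := by
  rintro rfl
  rw [zero_smul] at h
  apply hf
  have : linSubstRep σ k γ⁻¹ (linSubstRep σ k γ f) = f := by
    rw [← Module.End.mul_apply, ← map_mul, inv_mul_cancel, map_one, Module.End.one_apply]
  rw [← this, h, map_zero]

/-- If `γ · f = c • f`, `c ≠ 0`, then `γ⁻¹ · f = c⁻¹ • f` (private copy). [folklore] -/
private theorem linSubstRep_inv_eq_smul' {γ : GL σ k} {f : MvPolynomial σ k} {c : k} (hc : c ≠ 0)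
    (h : linSubstRep σ k γ f = c • f) : linSubstRep σ k γ⁻¹ f = c⁻¹ • f := by
  have h1 : linSubstRep σ k γ⁻¹ (linSubstRep σ k γ f) = f := by
    rw [← Module.End.mul_apply, ← map_mul, inv_mul_cancel, map_one, Module.End.one_apply]
  rw [h, map_smul] at h1
  calc linSubstRep σ k γ⁻¹ f = c⁻¹ • (c • linSubstRep σ k γ⁻¹ f) := by
        rw [smul_smul, inv_mul_cancel₀ hc, one_smul]
    _ = c⁻¹ • f := by rw [h1]

/-- Evaluation at `v̂`, restricted to a `G`-submodule of `k[Sym^m]_d`, transforms like `v̂^d`: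
`F(γ⁻¹ · v̂) = c^{-d} F(v̂)` for `γ · v = c • v`, `F` of degree `d` (the computation of Prop. 4.2,
polynomial level). [cite: MulmuleySohoniGCT2SIAM2008, Prop. 4.2 (arXiv cs/0612134 Prop. 5.2, main.tex L1041–1077)] -/
theorem aeval_formCoeff_coordRep_of_eq_smul {v : MvPolynomial σ k} {m d : ℕ} {γ : GL σ k} {c : k}
    (hc : c ≠ 0) (hγ : linSubstRep σ k γ v = c • v) {F : MvPolynomial (DegIdx σ m) k}
    (hF : F.IsHomogeneous d) :
    aeval (formCoeff m v) (coordRep σ k m γ F) = (c⁻¹) ^ d * aeval (formCoeff m v) F := by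
  rw [coordRep_apply, aeval_formCoeff_coordSubst, linSubstRep_inv_eq_smul' hc hγ, formCoeff_smul]
  exact Literature.RingTheory.MvPolynomial.eval_smul_of_isHomogeneous hF _ _

/-- **Prop. 6.2 / Prop. 4.2 "in particular"** (Mulmuley–Sohoni 2008 `[L1203–1208]`: "the `G`-modules
in the representation-theoretic data `Π_v` … are contained in `I_V[v]`. This follows from
Proposition 4.2"; Prop. 4.2 `[L1047–1049]`: "a `G`-module `S ⊆ ℂ[V]_d` not satisfying this
constraint belongs to the ideal `I_V[h]`"): a member `W` of `Π_v(d)` lies in the vanishing ideal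
`I(GL · v)` of the orbit. Hypotheses: `v ≠ 0` and `G · [v] = GL · [v]` (`HasFullProjectiveOrbit`;
automatic for `G = GL`, and for `G = SL` over `ℂ` by `hasFullProjectiveOrbit_slSubgroup`); MS's
stability hypothesis is only needed to make `Σ_v` meaningful. Proof as printed: evaluation at `v̂`
on `W` transforms like `v̂^d`, hence vanishes; by `G`-stability all of `W` vanishes on `G · v̂`,
by homogeneity on the cone, hence on `GL · v̂`.
[cite: MulmuleySohoniGCT2SIAM2008, Prop. 6.2 with Prop. 4.2 (arXiv cs/0612134 Props. 7.2, 5.2; main.tex L1203–1208, L1041–1067)] -/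
theorem IsPiDatum.le_orbitVanishingIdeal {G : Subgroup (GL σ k)} {v : MvPolynomial σ k} {m d : ℕ}
    {W : Subrepresentation (coordRep σ k m)} (hW : IsPiDatum G v m d W) (hv0 : v ≠ 0)
    (hG : HasFullProjectiveOrbit G v) :
    ∀ F ∈ W.toSubmodule, F ∈ orbitVanishingIdeal v m := by
  obtain ⟨hWd, -, hφ⟩ := hW
  -- evaluation at `v̂` restricted to `W` is semi-invariant, hence zero
  set φ : W.toSubmodule →ₗ[k] k := (aeval (formCoeff m v)).toLinearMap ∘ₗ W.toSubmodule.subtype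
    with hφdef
  have hsemi : IsEvalSemiInvariant G v d W.toRepresentation φ := by
    intro γ _ c hc
    apply LinearMap.ext
    intro F
    have hc0 : c ≠ 0 := ne_zero_of_linSubstRep_eq_smul' hv0 hc
    have hF : (F : MvPolynomial (DegIdx σ m) k).IsHomogeneous d :=
      (mem_homogeneousSubmodule d _).mp (hWd F.2)
    change aeval (formCoeff m v) (coordRep σ k m γ (F : MvPolynomial (DegIdx σ m) k)) =
      (c⁻¹) ^ d • aeval (formCoeff m v) (F : MvPolynomial (DegIdx σ m) k)
    rw [aeval_formCoeff_coordRep_of_eq_smul hc0 hc hF, smul_eq_mul]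
  have hφ0 : φ = 0 := hφ φ hsemi
  have hvan : ∀ F ∈ W.toSubmodule, aeval (formCoeff m v) F = 0 := fun F hF => by
    have := LinearMap.congr_fun hφ0 ⟨F, hF⟩
    rw [LinearMap.zero_apply] at this
    exact this
  -- hence every `F ∈ W` vanishes on the whole orbit `GL · v̂`
  intro F hFW
  have hF : F.IsHomogeneous d := (mem_homogeneousSubmodule d _).mp (hWd hFW)
  refine mem_orbitVanishingIdeal_iff.mpr fun γ => ?_
  obtain ⟨c, γ', hγ', hγ⟩ := hG γ
  have h1 : aeval (formCoeff m (linSubstRep σ k γ' v)) F = 0 := by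
    have h2 := hvan _ (W.apply_mem_toSubmodule γ'⁻¹ hFW)
    rwa [coordRep_apply, aeval_formCoeff_coordSubst, inv_inv] at h2
  rw [hγ, formCoeff_smul]
  change eval (c • formCoeff m (linSubstRep σ k γ' v)) F = 0
  rw [Literature.RingTheory.MvPolynomial.eval_smul_of_isHomogeneous hF]
  change c ^ d * aeval (formCoeff m (linSubstRep σ k γ' v)) F = 0
  rw [h1, mul_zero]

/-- **Prop. 6.2 for `Σ_v`** ("… and hence `Σ_v`" `[L1203–1208]`), dual form: an irreducible
`G`-submodule of `k[Sym^m]_d` whose dual has no nonzero `(G ∩ G_v̂)`-invariant lies in `I(GL · v)`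
(`v ≠ 0`, `G · [v] = GL · [v]`). [cite: MulmuleySohoniGCT2SIAM2008, Prop. 6.2 (arXiv cs/0612134 Prop. 7.2, main.tex L1203–1208)] -/
theorem IsDualSigmaDatum.le_orbitVanishingIdeal {G : Subgroup (GL σ k)} {v : MvPolynomial σ k}
    {m d : ℕ} {W : Subrepresentation (coordRep σ k m)} (hS : IsDualSigmaDatum G v m W)
    (hWd : W.toSubmodule ≤ homogeneousSubmodule (DegIdx σ m) k d)
    (hirr : W.toRepresentation.IsIrreducible) (hv0 : v ≠ 0) (hG : HasFullProjectiveOrbit G v) :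
    ∀ F ∈ W.toSubmodule, F ∈ orbitVanishingIdeal v m :=
  (hS.isPiDatum hWd hirr).le_orbitVanishingIdeal hv0 hG

/-- Consequently a member of `Π_v(d)` dies in the coordinate ring `k[Δ[v]] = k[Sym^m] ⧸ I(GL·v)`:
its image in `R_V[v]` is zero (so it "does not occur" there through this copy) — the link between
Def. 6.1 and the obstructions of §1 (`v ≠ 0`, `G · [v] = GL · [v]`).
[cite: MulmuleySohoniGCT2SIAM2008, Prop. 6.2 (arXiv cs/0612134 Prop. 7.2, main.tex L1203–1208)] -/
theorem IsPiDatum.map_mkₐ_eq_bot {G : Subgroup (GL σ k)} {v : MvPolynomial σ k} {m d : ℕ}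
    {W : Subrepresentation (coordRep σ k m)} (hW : IsPiDatum G v m d W) (hv0 : v ≠ 0)
    (hG : HasFullProjectiveOrbit G v) :
    W.toSubmodule.map (Ideal.Quotient.mkₐ k (orbitVanishingIdeal v m)).toLinearMap = ⊥ := by
  rw [Submodule.eq_bot_iff]
  rintro _ ⟨F, hF, rfl⟩
  rw [AlgHom.toLinearMap_apply, Ideal.Quotient.mkₐ_eq_mk]
  exact Ideal.Quotient.eq_zero_iff_mem.mpr (hW.le_orbitVanishingIdeal hv0 hG F hF)

end PiSigma

/-! ## §12 `G`-separability of `SL_2 × SL_2 ⊆ SL_4`: Prop. 12.5 in its symmetric-group form -/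

section Separability

open Literature.NumberTheory.DiophantineGeometry

/-- **Mulmuley–Sohoni 2008, Prop. 12.5** `[tex:cs_0612134 main.tex L3409–3411]` — a THEOREM in
print: the separability statement 12.3 (label `conjsln`: `SL_n(ℂ) × SL_n(ℂ) ⊆ SL_{n²}(ℂ)` is
separable, Weyl-module form) "holds for `n = 2`". Typed in the SYMMETRIC-GROUP FORM that the
printed proof establishes `[L3385–3394, L3417–3420]`: "We need to show that for every nontrivial
pair of `(λ, μ)` of row-shaped Young diagrams, with `|λ|` and `|μ|` even, there exists an even `m`"
[and, by the reformulation `[L3385–3394]` with `n = 2`, "a `ρ` of size `m` such that `W_ρ` occurs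
in the decomposition of `W_{λ(m)} ⊗ W_{μ(m)}` as an `S_m`-module, but not in the decomposition of
`W_δ ⊗ W_δ`, where `δ` is the rectangular Young diagram of height `n` and size `m`", `m ≥ n`,
`λ(m)` = `λ` with columns of length `n` added up to size `m`]. With `λ = (a)`, `μ = (b)` (`a`, `b`
even, not both `0`), `n = 2`: `λ(m) = ((m+a)/2, (m-a)/2)`, `μ(m) = ((m+b)/2, (m-b)/2)`,
`δ = (m/2, m/2)`, and "`W_ρ` occurs in `W_α ⊗ W_β`" is `0 < kroneckerCoeff ℂ α β ρ`
(`SymmetricGroupReps.lean`: `g(α, β, ρ) = dim Hom_{S_m}(S^α ⊗ S^β, S^ρ)`). Partitions are pinned by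
their multisets of (nonzero) parts. NAMED FACT (D-0014): the printed proof `[L3417–3737]` uses the
Remmel–Whitehead formulas for two-row Kronecker products (eqremwhite) `[L3453–]`, not in the tree
(FACT-LIST R1); every instance `(a, b)` is a finite Kronecker-coefficient computation. MS state
`[L3383–3394]` that this symmetric-group form is EQUIVALENT to the Weyl-module form for `n = 2`;
that equivalence (Schur–Weyl duality, `[L3349–3381]`) is not formalised here.
[cite: MulmuleySohoniGCT2SIAM2008, Prop. 12.5 (arXiv cs/0612134 Prop. 13.5, main.tex L3385–3420)] -/
def MS08_prop_12_5 : Prop :=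
  ∀ a b : ℕ, Even a → Even b → ¬ (a = 0 ∧ b = 0) →
    ∃ (m : ℕ) (lam mu delta rho : Nat.Partition m),
      Even m ∧ 2 ≤ m ∧ a ≤ m ∧ b ≤ m ∧
      lam.parts = Multiset.filter (fun x => 0 < x) {(m + a) / 2, (m - a) / 2} ∧
      mu.parts = Multiset.filter (fun x => 0 < x) {(m + b) / 2, (m - b) / 2} ∧
      delta.parts = {m / 2, m / 2} ∧
      0 < kroneckerCoeff ℂ lam mu rho ∧ kroneckerCoeff ℂ delta delta rho = 0

end Separability

end Literature.Computability.AlgebraicComplexity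

end
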